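import Summits.AnomalousDissipation.AnomalousDissipation.Theses.NeutralTaylorWaves
import Summits.AnomalousDissipation.AnomalousDissipation.Theorems.NonresonantSelection.Negative.BorderedTestVectors
import Literature.Analysis.FluidPDE.EulerGalerkinLeibniz
import Literature.Analysis.FluidPDE.CompressibleEulerLinearizedDerivative
import Literature.Analysis.FluidPDE.TorusPressurePoisson
import Literature.Analysis.FluidPDE.Antidivergence

/-!
# Negative lemmas for crux `NeutralTaylorWaves.NewtonRealisation` (stmt-AnomalousDissipation-16315):
# the translation mode is an exact kernel vector — the BORDER of the a-priori bound is load-bearing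

The crux realises exact steady states by a bordered Newton–Kantorovich step whose only spectral
input is the BORDERED `L²` a-priori bound of the route target (last clause of
`NonresonantTaylorWaves`; unknowns `(v, b)`, data `(…, ⟨v, ∂₃w⟩)`).  The picked line
(`Cruxes/NewtonRealisation/Lines/Sketch.lean`, stub `stub_quantPersistenceCore` = `C⁺`) applies it at
EXACT drifted steady states `u₀·∇u₀ − νΔu₀ + ∇p₀ − c∂₃u₀ = f₀`.  Kernel-checked here
(refuter cdisprove, 2026-08-17):

* `linearisation_translationMode_eq_zero` — if the force is `x₃`-INVARIANT (`∂₃f₀ ≡ 0`; the route's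
  forces `f = P div⟨V⊗V⟩_θ` are), then the translation mode `(v, r) = (∂₃u₀, ∂₃p₀)` is an EXACT
  kernel vector of the UNBORDERED linearised steady operator
  `v ↦ u₀·∇v + v·∇u₀ − νΔv + ∇r − c∂₃v` (differentiate the steady equation in `x₃`).
* `unborderedBound_false_of_exact` — hence NO unbordered `L²` a-priori bound
  (the crux's clause with the drift unknown `b` and the phase functional `⟨v, ∂₃w⟩` deleted, written
  inline) holds at such a state unless `‖∂₃u₀‖₂ = 0`, whatever the constant.
* `unborderedBound_false_of_borderedBound` — and since the crux's BORDERED bound forces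
  `‖∂₃u₀‖₂² ≥ M₀⁻² > 0` (`NonresonantSelection.Negative.bordered_one_le`, landed), the bordered and
  the unbordered bounds are MUTUALLY EXCLUSIVE on exact states of `x₃`-invariant forces: every
  persistence / implicit-function lemma for this crux must carry the border `(b, ⟨·, ∂₃u₀⟩)`; an
  unbordered inverse bound is not false but VACUOUS on the states the crux produces (this is target
  T1 of card `force-side-persistence` in its correct form).

Only landed tree calculus is used (`partialDeriv_convect_eq_add`, `partialDeriv_laplacian`,
`partialDeriv_gradient_eq`, `partialDeriv_divergence_eq`, `integral_partialDeriv_eq_zero_holds`).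
-/

set_option linter.dupNamespace false

noncomputable section

namespace Summit.AnomalousDissipation.AnomalousDissipation.Theorems.NewtonRealisation.Negative

open MeasureTheory
open Literature.Analysis.FunctionSpaces Literature.Analysis.FunctionSpaces.Torus

/-- **The translation mode is an exact kernel vector.** For an exact smooth drifted steady state
`u₀·∇u₀ − νΔu₀ + ∇p₀ − c∂₃u₀ = f₀` of an `x₃`-invariant force (`∂₃f₀ ≡ 0`), the pair
`(∂₃u₀, ∂₃p₀)` annihilates the linearised operator: `u₀·∇(∂₃u₀) + (∂₃u₀)·∇u₀ − νΔ(∂₃u₀) + ∇(∂₃p₀)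
− c∂₃(∂₃u₀) = ∂₃f₀ = 0` (Leibniz for the convective term, `∂₃` commutes with `Δ`, `∇`, `∂₃`). -/
theorem linearisation_translationMode_eq_zero {ν c : ℝ} {u₀ f₀ : (UnitAddTorus (Fin 3)) → (EuclideanSpace ℝ (Fin 3))} {p₀ : (UnitAddTorus (Fin 3)) → ℝ}
    (hu : IsSmooth u₀) (hp : IsSmooth p₀)
    (heq : ∀ x, Torus.convect u₀ u₀ x - ν • Torus.laplacian u₀ x + Torus.gradient p₀ x -
        c • Torus.partialDeriv (2 : Fin 3) u₀ x = f₀ x)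
    (hf : ∀ x, Torus.partialDeriv (2 : Fin 3) f₀ x = 0) (x : (UnitAddTorus (Fin 3))) :
    Torus.convect u₀ (Torus.partialDeriv (2 : Fin 3) u₀) x +
        Torus.convect (Torus.partialDeriv (2 : Fin 3) u₀) u₀ x -
        ν • Torus.laplacian (Torus.partialDeriv (2 : Fin 3) u₀) x +
        Torus.gradient (Torus.partialDeriv (2 : Fin 3) p₀) x -
        c • Torus.partialDeriv (2 : Fin 3) (Torus.partialDeriv (2 : Fin 3) u₀) x = 0 := by
  -- smoothness bookkeeping
  have hA : IsSmooth (Torus.convect u₀ u₀) := hu.convect hu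
  have hL : IsSmooth (Torus.laplacian u₀) := hu.laplacian
  have hG : IsSmooth (Torus.gradient p₀) := hp.gradient
  have hD : IsSmooth (Torus.partialDeriv (2 : Fin 3) u₀) := hu.partialDeriv 2
  have hA1 : IsContDiff 1 (Torus.convect u₀ u₀) := hA.isContDiff (by simp)
  have hL1 : IsContDiff 1 (Torus.laplacian u₀) := hL.isContDiff (by simp)
  have hG1 : IsContDiff 1 (Torus.gradient p₀) := hG.isContDiff (by simp)
  have hD1 : IsContDiff 1 (Torus.partialDeriv (2 : Fin 3) u₀) := hD.isContDiff (by simp)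
  have hνL1 : IsContDiff 1 (fun y => ν • Torus.laplacian u₀ y) := hL1.smul ν
  have hAL1 : IsContDiff 1 (fun y => Torus.convect u₀ u₀ y - ν • Torus.laplacian u₀ y) :=
    hA1.sub hνL1
  have hALG1 : IsContDiff 1
      (fun y => Torus.convect u₀ u₀ y - ν • Torus.laplacian u₀ y + Torus.gradient p₀ y) :=
    hAL1.add hG1
  have hcD1 : IsContDiff 1 (fun y => c • Torus.partialDeriv (2 : Fin 3) u₀ y) := hD1.smul c
  -- the steady equation as an equality of functions, differentiated in `x₃`
  have hfun : (fun y => Torus.convect u₀ u₀ y - ν • Torus.laplacian u₀ y + Torus.gradient p₀ y -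
      c • Torus.partialDeriv (2 : Fin 3) u₀ y) = f₀ := funext heq
  have hdiff : Torus.partialDeriv (2 : Fin 3) (fun y => Torus.convect u₀ u₀ y -
      ν • Torus.laplacian u₀ y + Torus.gradient p₀ y - c • Torus.partialDeriv (2 : Fin 3) u₀ y) x = 0 := by
    rw [hfun]; exact hf x
  -- expand `∂₃` of the left-hand side term by term
  rw [Literature.Analysis.FluidPDE.Torus.partialDeriv_sub_at hALG1 hcD1,
    Literature.Analysis.FluidPDE.Torus.partialDeriv_add_apply hAL1 hG1,
    Literature.Analysis.FluidPDE.Torus.partialDeriv_sub_at hA1 hνL1,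
    Literature.Analysis.FluidPDE.Torus.partialDeriv_const_smul_at hL1,
    Literature.Analysis.FluidPDE.Torus.partialDeriv_const_smul_at hD1,
    congrFun (Literature.Analysis.FluidPDE.Torus.partialDeriv_convect_eq_add hu hu (2 : Fin 3)) x,
    Literature.Analysis.FluidPDE.Torus.partialDeriv_laplacian hu (2 : Fin 3) x,
    Literature.Analysis.FluidPDE.CompressibleEuler.partialDeriv_gradient_eq hp (2 : Fin 3) x] at hdiff
  rw [← hdiff]
  abel

/-- **No unbordered a-priori bound at an exact state of an `x₃`-invariant force** (unless the state
is itself `x₃`-invariant in `L²`): test the bound with the translation mode `(∂₃u₀, ∂₃p₀)` — smooth,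
divergence free, mean zero — whose image is `0`. Holds for EVERY constant `M`. -/
theorem unborderedBound_false_of_exact {ν c : ℝ} {u₀ f₀ : (UnitAddTorus (Fin 3)) → (EuclideanSpace ℝ (Fin 3))} {p₀ : (UnitAddTorus (Fin 3)) → ℝ}
    (hu : IsSmooth u₀) (hp : IsSmooth p₀) (hdiv : IsDivFree u₀)
    (heq : ∀ x, Torus.convect u₀ u₀ x - ν • Torus.laplacian u₀ x + Torus.gradient p₀ x -
        c • Torus.partialDeriv (2 : Fin 3) u₀ x = f₀ x)
    (hf : ∀ x, Torus.partialDeriv (2 : Fin 3) f₀ x = 0)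
    (h3 : 0 < MeasureTheory.integral MeasureTheory.volume
        (fun x => ‖Torus.partialDeriv (2 : Fin 3) u₀ x‖ ^ 2))
    (M : ℝ) :
    ¬ (∀ (v : (UnitAddTorus (Fin 3)) → (EuclideanSpace ℝ (Fin 3))) (r : (UnitAddTorus (Fin 3)) → ℝ), IsSmooth v → IsSmooth r → IsDivFree v → HasZeroMean v →
      MeasureTheory.integral MeasureTheory.volume (fun x => ‖v x‖ ^ 2) ≤
        M ^ 2 * MeasureTheory.integral MeasureTheory.volume (fun x =>
          ‖Torus.convect u₀ v x + Torus.convect v u₀ x - ν • Torus.laplacian v x +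
            Torus.gradient r x - c • Torus.partialDeriv (2 : Fin 3) v x‖ ^ 2)) := by
  intro h
  have hD : IsSmooth (Torus.partialDeriv (2 : Fin 3) u₀) := hu.partialDeriv 2
  -- the translation mode is divergence free and mean zero
  have hDdiv : IsDivFree (Torus.partialDeriv (2 : Fin 3) u₀) := by
    intro x
    rw [← Literature.Analysis.FluidPDE.CompressibleEuler.partialDeriv_divergence_eq hu (2 : Fin 3) x]
    have h0 : Torus.divergence u₀ = fun _ => (0 : ℝ) := funext hdiv
    rw [h0]
    simp [Torus.partialDeriv, Torus.lineDeriv]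
  have hDmean : HasZeroMean (Torus.partialDeriv (2 : Fin 3) u₀) :=
    Torus.integral_partialDeriv_eq_zero_holds hu (2 : Fin 3)
  have key := h _ _ hD (hp.partialDeriv 2) hDdiv hDmean
  have hzero : (fun x => ‖Torus.convect u₀ (Torus.partialDeriv (2 : Fin 3) u₀) x +
      Torus.convect (Torus.partialDeriv (2 : Fin 3) u₀) u₀ x -
      ν • Torus.laplacian (Torus.partialDeriv (2 : Fin 3) u₀) x +
      Torus.gradient (Torus.partialDeriv (2 : Fin 3) p₀) x -
      c • Torus.partialDeriv (2 : Fin 3) (Torus.partialDeriv (2 : Fin 3) u₀) x‖ ^ 2) =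
      fun _ => (0 : ℝ) := by
    funext x
    rw [linearisation_translationMode_eq_zero hu hp heq hf x]
    simp
  rw [hzero] at key
  simp only [integral_zero, mul_zero] at key
  linarith

/-- **Bordered and unbordered bounds are mutually exclusive on exact states of `x₃`-invariant
forces.** If the crux's BORDERED a-priori bound (verbatim the last clause of
`NeutralTaylorWaves.NonresonantTaylorWaves`, constant `M₀`) holds at an exact drifted steady state of
an `x₃`-invariant force, then `‖∂₃u₀‖₂² ≥ M₀⁻² > 0` (border test `(0, 0, 1)`,
`NonresonantSelection.Negative.bordered_one_le`) and therefore NO unbordered bound holds, for any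
constant: the border `(b, ⟨·, ∂₃u₀⟩)` is load-bearing in `NewtonRealisation` and in the line's
transfer `C⁺`. -/
theorem unborderedBound_false_of_borderedBound {ν c M₀ : ℝ} {u₀ f₀ : (UnitAddTorus (Fin 3)) → (EuclideanSpace ℝ (Fin 3))} {p₀ : (UnitAddTorus (Fin 3)) → ℝ}
    (hu : IsSmooth u₀) (hp : IsSmooth p₀) (hdiv : IsDivFree u₀)
    (heq : ∀ x, Torus.convect u₀ u₀ x - ν • Torus.laplacian u₀ x + Torus.gradient p₀ x -
        c • Torus.partialDeriv (2 : Fin 3) u₀ x = f₀ x)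
    (hf : ∀ x, Torus.partialDeriv (2 : Fin 3) f₀ x = 0)
    (hB : ∀ (v : (UnitAddTorus (Fin 3)) → (EuclideanSpace ℝ (Fin 3))) (r : (UnitAddTorus (Fin 3)) → ℝ) (b : ℝ), IsSmooth v → IsSmooth r → IsDivFree v →
      HasZeroMean v →
      MeasureTheory.integral MeasureTheory.volume (fun x => ‖v x‖ ^ 2) + b ^ 2 ≤
        M₀ ^ 2 * (MeasureTheory.integral MeasureTheory.volume (fun x =>
          ‖Torus.convect u₀ v x + Torus.convect v u₀ x - ν • Torus.laplacian v x +
            Torus.gradient r x - c • Torus.partialDeriv (2 : Fin 3) v x -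
            b • Torus.partialDeriv (2 : Fin 3) u₀ x‖ ^ 2) +
          (MeasureTheory.integral MeasureTheory.volume (fun x =>
            inner ℝ (v x) (Torus.partialDeriv (2 : Fin 3) u₀ x))) ^ 2))
    (M : ℝ) :
    ¬ (∀ (v : (UnitAddTorus (Fin 3)) → (EuclideanSpace ℝ (Fin 3))) (r : (UnitAddTorus (Fin 3)) → ℝ), IsSmooth v → IsSmooth r → IsDivFree v → HasZeroMean v →
      MeasureTheory.integral MeasureTheory.volume (fun x => ‖v x‖ ^ 2) ≤
        M ^ 2 * MeasureTheory.integral MeasureTheory.volume (fun x =>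
          ‖Torus.convect u₀ v x + Torus.convect v u₀ x - ν • Torus.laplacian v x +
            Torus.gradient r x - c • Torus.partialDeriv (2 : Fin 3) v x‖ ^ 2)) := by
  have h1 := NonresonantSelection.Negative.bordered_one_le hB
  have hpos : 0 < MeasureTheory.integral MeasureTheory.volume
      (fun x => ‖Torus.partialDeriv (2 : Fin 3) u₀ x‖ ^ 2) := by
    by_contra hle
    rw [not_lt] at hle
    have hnn : 0 ≤ MeasureTheory.integral MeasureTheory.volume
        (fun x => ‖Torus.partialDeriv (2 : Fin 3) u₀ x‖ ^ 2) := integral_nonneg fun _ => by positivity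
    have h0 : MeasureTheory.integral MeasureTheory.volume
        (fun x => ‖Torus.partialDeriv (2 : Fin 3) u₀ x‖ ^ 2) = 0 := le_antisymm hle hnn
    rw [h0, mul_zero] at h1
    exact absurd h1 (by norm_num)
  exact unborderedBound_false_of_exact hu hp hdiv heq hf hpos M

end Summit.AnomalousDissipation.AnomalousDissipation.Theorems.NewtonRealisation.Negative

end
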